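import Literature.IUT.HodgeTheaters.PiAvatarBaseKitThetaNFInstances
import Literature.IUT.HodgeTheaters.PiAvatarNFKitThetaInstances
import HarnessLib

/-!
# [IUTchI] Def 4.1 / Def 6.1 / Prop 6.7 AT THE GENUINE Θ-NF STAND-IN KIT: the §4 base-Θ datum, its core agreement `KitCore`, the `φ^NF`
# dictionary and law (γ) `ThetaAgrees` — abc-iut-L5-t3's `PiAvatarKitCore` (p452433) RE-RUN with the binder `E : EvalBinder` REPLACED by the
# binder CONSTRUCTED from evaluation sections (D-JΘ1-2 (iv-b′), file (C″); defs + `rfl` bookkeeping + laws)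

S. Mochizuki, *Inter-universal Teichmüller theory I*, kurims manuscript (May 2020), Definition 4.1 (i)–(vi) pp. 95–98, Example 4.3 p. 99,
Example 4.4 (i)(ii)(iv) pp. 106–107, Definition 6.1 (i)–(vii) pp. 156–159, Proposition 6.7 p. 167 ([IUTchI] Def 6.1 (i) p.156)
[claim: Mochizuki2012, status: disputed] (D-0012 claim key, series status DISPUTED — constructions over abc-iut-L5-t2's REAL `InitialThetaData`;
nothing of the series is asserted, no side is taken on [IUTchIII] Cor. 3.12).

## What this file builds and why

At the D13 stand-in kit `baseKitNFStandIn` abc-iut-L5-t3 built the §4 datum `baseThetaDatumStandIn Ev`, the identity dictionary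
`kitCoreStandIn Ev` and law (γ) `thetaAgrees_standIn` MODULO a binder `Ev : EvalBinder` (p452433) — which abc-iut-w4-d054 then proved
UNINHABITED at closed `Π_v̲` (p456090/p456525: coset maps have only invertible endomorphisms).  Over the Θ-NF stand-in kit
`baseKitThetaNFStandIn CG hS M hA hI` (abc-iut-L5-t4 `PiAvatarBaseKitThetaNFInstances`, ambient `ThetaAmb`) the binder is CONSTRUCTED from
abc-iut-L5-t3's evaluation-section binders `ES : ∀ v ∈ V̲^bad, EvalSectionBinder (localDataStandIn v) (Gv v)` (`evalBinderThetaNFStandIn`), the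
NF kit is abc-iut-L5-t3's `nfKitThetaStandIn` (files (D)/(D′): `nfKitThetaOfData` at the stand-in data, `hNF` discharged from `M`), the mono-analytic
block is tautological, `5 ≤ l` is Def 3.1 (c) (`five_le_l`), `V̲^bad ∩ V̲^arc = ∅ ≠ V̲^bad` are theorems: so
* `baseThetaDatumThetaStandIn ES : BaseThetaDatum` — THE §4 BASE-Θ DATUM OF THE REAL INITIAL Θ-DATA over the Θ-NF stand-in kit;
* `kitCoreThetaStandIn ES` — the FROZEN `KitCore`, INHABITED; `nfLinkThetaStandIn ES` — the `φ^NF` dictionary;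
* `thetaAgrees_thetaStandIn ES` — law (γ) `KitCore.ThetaAgrees` for the multiplicative kit generated by the sections;
* `exists_endo_not_isIso_thetaStandIn` — (O1) of p456090 met at every bad index (by tag; not a statement about outer homomorphisms).
DISPLAYED BINDERS, complete list: the kit's {`CG`, `hS`, `M : TorsionMonodromy`, `hA`, `hI`} «[`X̲→`-profinite stand-in at `v̲ ∈ V̲^bad`]» and
{`ES`}.  NON-VACUITY of `ES` = row «EVALSECT-NV» (abc-iut-w4-d077 (E3): a certified `ℤ/l`-character of a subgroup of `G_K`; abc-iut-L5-t3
`labelRigid_iff_range_not_conj`).  PRICE IN FAITHFULNESS as recorded in `PiAvatarThetaAmb`.  typed ≠ inhabited ≠ proved; binder ≠ fact;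
a stand-in witnesses the consistency of OUR binders only.
-/

noncomputable section

namespace Literature.IUT.HodgeTheaters

open CategoryTheory

universe u v w

section KitCoreTheta

variable {F : Type u} {K : Type v} {Fbar : Type w} [Field F] [NumberField F] [Field K] [NumberField K]
  [Algebra F K] [Field Fbar] [Algebra F Fbar] [Algebra K Fbar]
  {E : WeierstrassCurve F} [E.IsElliptic] {l : ℕ} {Pb : BadPlacePredicates K}
  (D : InitialThetaData F K Fbar E l Pb) (CG : D.geom.pe.CuspGalois) (hS : D.CuspClassesNormaliserStable) [Fact l.Prime]
  (M : D.TorsionMonodromy) (hA : D.geom.pe.ArrowCoveringClaims)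
  (hI : ∀ k ∈ D.geom.pe.inertia D.geom.pe.ε1, M.tau (D.geom.embK k) = 0)

namespace InitialThetaData

/-! ### §1. The §4 base-Θ datum, `KitCore`, `NFLink` at the Θ-NF stand-in kit — the binder `E` CONSTRUCTED from `ES` -/

variable {Gv : D.IndexCopy → Subgroup (Fbar ≃ₐ[F] Fbar)}
  (ES : ∀ v, v ∈ D.indexCopyBad → EvalSectionBinder (D.localDataStandIn CG hS M hA hI v) (Gv v))

/-- **THE [IUTchI] §4 BASE-Θ DATUM OF THE REAL INITIAL Θ-DATA over the Θ-NF stand-in kit**: `ofKitCore` at `K := baseKitThetaNFStandIn`,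
`N := nfKitThetaStandIn`, `B :=` tautological, `hl5 := five_le_l`, the two place theorems, and `E := evalBinderThetaNFStandIn … ES` — Example 4.4's
evaluation sections as DEGENERATE morphisms of `ThetaAmb` generated by the sections `ES`. ([IUTchI] Def 4.1 p.95) [claim: Mochizuki2012, status: disputed] -/
def baseThetaDatumThetaStandIn : BaseThetaDatum.{w} :=
  BaseThetaDatum.ofKitCore (D.baseKitThetaNFStandIn CG hS M hA hI) D.five_le_l (D.indexCopy_not_mem_arc_of_mem_bad)
    D.indexCopyBad_nonempty (D.nfKitThetaStandIn CG hS M hA hI) (PMBaseKit.MonoBinder.tautological _)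
    (D.evalBinderThetaNFStandIn CG hS M hA hI D.five_le_l ES)

/-- **THE FROZEN `KitCore` AT THE GENUINE Θ-NF STAND-IN KIT, INHABITED**: the identity dictionary between `baseThetaDatumThetaStandIn ES` and
`baseKitThetaNFStandIn`. ([IUTchI] Def 6.1 p.156) [claim: Mochizuki2012, status: disputed] -/
def kitCoreThetaStandIn :
    (D.baseThetaDatumThetaStandIn CG hS M hA hI ES).KitCore (D.baseKitThetaNFStandIn CG hS M hA hI) :=
  BaseThetaDatum.KitCore.ofKit (D.baseKitThetaNFStandIn CG hS M hA hI) D.five_le_l (D.indexCopy_not_mem_arc_of_mem_bad)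
    D.indexCopyBad_nonempty (D.nfKitThetaStandIn CG hS M hA hI) (PMBaseKit.MonoBinder.tautological _)
    (D.evalBinderThetaNFStandIn CG hS M hA hI D.five_le_l ES)

/-- **The `φ^NF` dictionary over `kitCoreThetaStandIn`** (identity). ([IUTchI] Ex 4.3 (ii) p.99) [claim: Mochizuki2012, status: disputed] -/
def nfLinkThetaStandIn : (D.kitCoreThetaStandIn CG hS M hA hI ES).NFLink :=
  BaseThetaDatum.NFLink.ofKit (D.baseKitThetaNFStandIn CG hS M hA hI) D.five_le_l (D.indexCopy_not_mem_arc_of_mem_bad)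
    D.indexCopyBad_nonempty (D.nfKitThetaStandIn CG hS M hA hI) (PMBaseKit.MonoBinder.tautological _)
    (D.evalBinderThetaNFStandIn CG hS M hA hI D.five_le_l ES)

/-! ### §2. Bookkeeping (`rfl`) -/

/-- Its prime is `l`. ([IUTchI] Def 3.1 (c) p.61) [claim: Mochizuki2012, status: disputed] -/
theorem baseThetaDatumThetaStandIn_l : (D.baseThetaDatumThetaStandIn CG hS M hA hI ES).l = l := rfl

/-- Its places are the index copy of `V̲`. ([IUTchI] Def 3.1 (e) p.62) [claim: Mochizuki2012, status: disputed] -/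
theorem baseThetaDatumThetaStandIn_V : (D.baseThetaDatumThetaStandIn CG hS M hA hI ES).V = D.IndexCopy := rfl

/-- Its bad places are `V̲^bad`. ([IUTchI] Def 3.1 (e) p.62) [claim: Mochizuki2012, status: disputed] -/
theorem baseThetaDatumThetaStandIn_isBad_iff (x : D.IndexCopy) :
    (D.baseThetaDatumThetaStandIn CG hS M hA hI ES).IsBad x ↔ D.indexCopyVal x ∈ D.Vbad := D.mem_indexCopyBad_iff x

/-- Its archimedean places are `V̲^arc`. ([IUTchI] Def 3.1 (e) p.62) [claim: Mochizuki2012, status: disputed] -/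
theorem baseThetaDatumThetaStandIn_isArc_iff (x : D.IndexCopy) :
    (D.baseThetaDatumThetaStandIn CG hS M hA hI ES).IsArc x ↔ D.indexCopyVal x ∈ D.Varc := D.mem_indexCopyArc_iff x

/-- Its `𝒟_v` is the Θ-NF stand-in kit's local model `ι(ℬ(Π_v̲)⁰)` (as a local object). ([IUTchI] Def 4.1 (i) p.95) [claim: Mochizuki2012, status: disputed] -/
theorem baseThetaDatumThetaStandIn_D (x : D.IndexCopy) :
    (D.baseThetaDatumThetaStandIn CG hS M hA hI ES).D x = (D.baseKitThetaNFStandIn CG hS M hA hI).localModel x := rfl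

/-- Its `𝒟^⊚` is `ℬ(Π_{C̲_K})⁰` among the isomorphs `GlobNF`. ([IUTchI] Def 4.1 (v) p.97) [claim: Mochizuki2012, status: disputed] -/
theorem baseThetaDatumThetaStandIn_DG : (D.baseThetaDatumThetaStandIn CG hS M hA hI ES).DG = D.gnfModel := rfl

/-- Its class `[ε]` is `1 ∈ 𝔽_l^⋇`. ([IUTchI] Ex 4.5 (ii) p.108) [claim: Mochizuki2012, status: disputed] -/
theorem baseThetaDatumThetaStandIn_εLab : (D.baseThetaDatumThetaStandIn CG hS M hA hI ES).εLab = (1 : FlStar l) := rfl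

/-- The dictionary's place map is the identity. ([IUTchI] Def 6.1 p.156) [claim: Mochizuki2012, status: disputed] -/
theorem kitCoreThetaStandIn_e (x : D.IndexCopy) : (D.kitCoreThetaStandIn CG hS M hA hI ES).e x = x := rfl

/-! ### §3. Non-vacuity of `KitCore`, (O1), and law (γ) at the Θ-NF stand-in kit -/

/-- **NON-VACUITY of the FROZEN `KitCore` at the genuine Θ-NF stand-in kit** — for every family of evaluation-section binders there IS a §4 datum of
the real initial Θ-data in `𝒟`-dictionary with the §6 Θ-NF-kit; contrast `isEmpty_kitCore_baseKitNFStandIn_of_isClosed`-type results of p456090/p456525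
at D13. ([IUTchI] Def 6.1 p.156) [claim: Mochizuki2012, status: disputed] -/
theorem nonempty_kitCore_thetaStandIn :
    Nonempty ((D.baseThetaDatumThetaStandIn CG hS M hA hI ES).KitCore (D.baseKitThetaNFStandIn CG hS M hA hI)) :=
  ⟨D.kitCoreThetaStandIn CG hS M hA hI ES⟩

include ES in
open Classical in
/-- **(O1) met at every bad index** (abc-iut-w4-d054 p456090's necessary condition): `𝒟_v̲` of the Θ-NF stand-in kit has a NON-invertible
endomorphism — `⟨true, 𝟙, φ^Θ_{v̲_j}⟩` (by tag; not a statement about outer homomorphisms). ([IUTchI] Ex 4.4 (i) p.106) [claim: Mochizuki2012, status: disputed] -/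
theorem exists_endo_not_isIso_thetaStandIn (v : D.IndexCopy) (hv : v ∈ D.indexCopyBad) (j : FlAbs l) :
    ∃ f : (D.baseKitThetaNFStandIn CG hS M hA hI).model v ⟶ (D.baseKitThetaNFStandIn CG hS M hA hI).model v, ¬ IsIso f := by
  haveI := M.normal_PiXund_subgroupOf_PiXK
  exact D.exists_endo_not_isIso_baseKitThetaNFOfData CG hS (D.toFlStarGlobal_surjective_of_torsionMonodromy M) D.indexCopyBad D.indexCopyArc
    (D.localDataStandIn CG hS M hA hI) v ((ES v hv).evalOuter j) ((ES v hv).isDegOver_evalOuter j)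

/-- **LAW (γ) `KitCore.ThetaAgrees` AT THE GENUINE Θ-NF STAND-IN KIT** for the multiplicative kit generated by the sections (`multKitThetaNFStandIn`):
Prop 6.7's «the kit's `φ^Θ_{v_j}` IS Example 4.4's `φ^Θ_{v_j}` read through the dictionary». DISPLAYED: {CG, hS, M, hA, hI} ∪ {ES}.
([IUTchI] Prop 6.7 p.167) [claim: Mochizuki2012, status: disputed] -/
theorem thetaAgrees_thetaStandIn :
    (D.kitCoreThetaStandIn CG hS M hA hI ES).ThetaAgrees (D.multKitThetaNFStandIn CG hS M hA hI ES) :=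
  D.thetaAgrees_baseKitThetaNFStandIn CG hS M hA hI D.five_le_l ES (D.nfKitThetaStandIn CG hS M hA hI) (PMBaseKit.MonoBinder.tautological _)

/-- **Existential packaging for certificates**: over the Θ-NF stand-in kit there EXIST a §4 datum `𝔡` with `𝔡.l = l`... stated concretely: a core
agreement and a multiplicative kit with law (γ). ([IUTchI] Prop 6.7 p.167) [claim: Mochizuki2012, status: disputed] -/
theorem exists_kitCore_thetaAgrees_thetaStandIn :
    ∃ (c : (D.baseThetaDatumThetaStandIn CG hS M hA hI ES).KitCore (D.baseKitThetaNFStandIn CG hS M hA hI))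
      (Mk : (D.baseKitThetaNFStandIn CG hS M hA hI).MultKit), c.ThetaAgrees Mk :=
  ⟨_, _, D.thetaAgrees_thetaStandIn CG hS M hA hI ES⟩

end InitialThetaData

end KitCoreTheta

end Literature.IUT.HodgeTheaters
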